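import Literature.NumberTheory.LFunctions.BondarenkoHeap2026Section6
import Literature.NumberTheory.Sieve.LargeSieveCharacters

/-!
# Bondarenko–Heap 2026, Lemma 8 ("translate-`L²`") — proved

A. Bondarenko, W. Heap, *Exceptional characters and small gaps between the zeros of the Riemann
zeta-function*, arXiv:2608.07399v1 (2026) [BondarenkoHeap2026], §6.4, Lemma 8 (TeX l.945–955,
`\label{lem:translate-L2}`, display (26)): "For arbitrary `b_k` supported on `k ≍ K`,
`∑_{x mod q} |∑_{k ≍ K} b_k χ(k + x)|² ≪_ε q^ε (q + K) ∑_{k ≍ K} |b_k|²`", `χ` the primitive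
quadratic character mod `q`.  The statement file `BondarenkoHeap2026Section6` types it as the
named fact `lemma8` (node BH26:Lem8 of the rh-crit/ah register, an `H` leaf of the apex cone of
`bondarenkoHeap2026_theorem1`).  THIS FILE PROVES IT: `lemma8_holds : lemma8`, with the constant
`C = 2` for every `ε > 0`.

LABEL (rh-crit C5, LADDER-RH §4 HELD «conditional bridges: exceptional zero ⇒ …»): NOT RH-BEARING.
WHAT THIS IS NOT: a mean-value bound for additively shifted Dirichlet characters — finite Fourier
analysis on `ℤ/qℤ`; nothing about `ζ`, RH, Siegel zeros or the Alternative Hypothesis. Nothing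
here bears on the truth of RH.

## The proof (deviation from print, recorded)

The printed proof (l.957–975) expands the square, evaluates `|∑_x χ(x+k)χ(x+ℓ)| ≪ (k−ℓ, q)` by the
Chinese remainder theorem using that `χ` is quadratic, and finishes with
`(k−ℓ,q) = ∑_{e | q, e | k−ℓ} φ(e)`, Cauchy's inequality in residue classes and the divisor bound.
We take the shorter road that Mathlib and the tree already pave — **completion**:
* for `χ` primitive mod `q`, `τ(χ̄) χ(y) = ∑_{a mod q} χ̄(a) e(ay/q)` for **every** residue `y`
  (Mathlib's `DirichletCharacter.IsPrimitive.fourierTransform_eq_inv_mul_gaussSum`, here as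
  `gaussSum_inv_mul_apply`) and `|τ(χ̄)|² = q` (the tree's
  `Literature.NumberTheory.Sieve.LargeSieve.norm_gaussSum_sq`);
* hence `τ(χ̄) ∑_k b_k χ(k+x) = ∑_a e(ax/q) · χ̄(a) β(a)` with `β(a) = ∑_k b_k e(ak/q)`, and two
  applications of Parseval on `ℤ/qℤ` (`sum_norm_sq_sum_mul_stdAddChar`, orthogonality
  `AddChar.sum_mulShift`) plus Cauchy–Schwarz inside residue classes
  (`sum_norm_sq_expSum_le`, `#{k ≤ N : k ≡ r} ≤ N/q + 1`, `card_filter_Icc_natCast_eq_le`) give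
  `∑_{x mod q} |∑_{k ≤ 2K} b_k χ(k+x)|² ≤ (q + 2K) ∑_k |b_k|² ≤ 2 q^ε (q + K) ∑_k |b_k|²`.
This yields (26) with `C = 2` uniformly in `ε`, WITHOUT the divisor bound and without using that
`χ` is quadratic (primitivity suffices; the typed hypotheses `IsQuadratic` and the support
condition `k ≍ K` are simply not needed).  No new named facts.

[cite: BondarenkoHeap2026, §6.4 Lemma 8 (26), TeX l.945–975]
-/

noncomputable section

open Finset Complex

open scoped ComplexConjugate

namespace Literature.NumberTheory.LFunctions.BondarenkoHeap2026

namespace CharacterSums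

open Literature.NumberTheory.Sieve.LargeSieve (norm_gaussSum_sq isPrimitive_inv)

variable {q : ℕ} [NeZero q]

/-! ### 1. Parseval on `ℤ/qℤ` -/

/-- kernel: `‖z‖² = z · z̄` read in `ℂ`. [folklore] -/
private theorem ofReal_norm_sq_eq_mul_conj (z : ℂ) : ((‖z‖ : ℂ)) ^ 2 = z * conj z := by
  rw [Complex.mul_conj, Complex.normSq_eq_norm_sq, Complex.ofReal_pow]

/-- kernel: complex conjugation inverts the standard additive character of `ℤ/qℤ`. [folklore] -/
private theorem conj_stdAddChar (t : ZMod q) :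
    conj (ZMod.stdAddChar t) = ZMod.stdAddChar (-t) := by
  rw [AddChar.starComp_apply (by rw [ZMod.ringChar_zmod_n]; exact NeZero.pos q), AddChar.inv_apply]

/-- kernel: orthogonality of the additive characters of `ℤ/qℤ`:
`∑_{x mod q} e(ax/q) e(−a'x/q) = q·[a = a']`. [folklore] -/
private theorem sum_stdAddChar_mul_stdAddChar_neg (a a' : ZMod q) :
    ∑ x : ZMod q, ZMod.stdAddChar (a * x) * ZMod.stdAddChar (-(a' * x)) =
      if a = a' then (q : ℂ) else 0 := by
  classical
  have h := AddChar.sum_mulShift (R := ZMod q) (a - a') (ZMod.isPrimitive_stdAddChar q)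
  simp only [ZMod.card, sub_eq_zero, Nat.cast_ite, Nat.cast_zero] at h
  rw [← h]
  refine Finset.sum_congr rfl fun x _ => ?_
  rw [← AddChar.map_add_eq_mul]
  congr 1
  ring

/-- **Parseval on `ℤ/qℤ`**: for complex coefficients `c_a`,
`∑_{x mod q} |∑_{a mod q} c_a e(ax/q)|² = q ∑_{a mod q} |c_a|²`.
[cite: CojocaruMurty2005, Thm 8.3.1 (proof)] -/
theorem sum_norm_sq_sum_mul_stdAddChar (c : ZMod q → ℂ) :
    ∑ x : ZMod q, ‖∑ a : ZMod q, c a * ZMod.stdAddChar (a * x)‖ ^ 2 =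
      (q : ℝ) * ∑ a : ZMod q, ‖c a‖ ^ 2 := by
  classical
  apply Complex.ofReal_injective
  push_cast
  simp only [ofReal_norm_sq_eq_mul_conj, map_sum, map_mul, conj_stdAddChar, Finset.sum_mul_sum]
  have inner : ∀ a : ZMod q, ∑ x : ZMod q, ∑ a' : ZMod q,
      c a * ZMod.stdAddChar (a * x) * (conj (c a') * ZMod.stdAddChar (-(a' * x))) =
        (q : ℂ) * (c a * conj (c a)) := by
    intro a
    rw [Finset.sum_comm]
    have hval : ∀ a' : ZMod q, ∑ x : ZMod q,
        c a * ZMod.stdAddChar (a * x) * (conj (c a') * ZMod.stdAddChar (-(a' * x))) =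
          if a = a' then (q : ℂ) * (c a * conj (c a')) else 0 := by
      intro a'
      have e1 : ∑ x : ZMod q,
          c a * ZMod.stdAddChar (a * x) * (conj (c a') * ZMod.stdAddChar (-(a' * x))) =
            c a * conj (c a') * ∑ x : ZMod q, ZMod.stdAddChar (a * x) * ZMod.stdAddChar (-(a' * x)) := by
        rw [Finset.mul_sum]
        exact Finset.sum_congr rfl fun x _ => by ring
      rw [e1, sum_stdAddChar_mul_stdAddChar_neg]
      split_ifs <;> ring
    rw [Fintype.sum_congr _ _ hval, Finset.sum_ite_eq, if_pos (Finset.mem_univ a)]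
  rw [Finset.sum_comm]
  rw [Fintype.sum_congr _ _ inner, ← Finset.mul_sum]

/-! ### 2. Exponential sums with coefficients on `1 ≤ k ≤ N`: folding into residue classes -/

omit [NeZero q] in
/-- kernel (counting): at most `N/q + 1` integers `k ∈ [1, N]` fall in one residue class mod `q`.
[folklore] -/
private theorem card_filter_Icc_natCast_eq_le (N : ℕ) (r : ZMod q) :
    #{k ∈ Icc 1 N | ((k : ℕ) : ZMod q) = r} ≤ N / q + 1 := by
  classical
  calc #{k ∈ Icc 1 N | ((k : ℕ) : ZMod q) = r}
      ≤ #(range (N / q + 1)) := by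
        refine Finset.card_le_card_of_injOn (fun k => k / q) (fun k hk => ?_) (fun k hk k' hk' h => ?_)
        · rw [Finset.coe_range, Set.mem_Iio]
          have hkN : k ≤ N := (Finset.mem_Icc.1 (Finset.mem_filter.1 hk).1).2
          exact Nat.lt_succ_of_le (Nat.div_le_div_right hkN)
        · have h1 := (Finset.mem_filter.1 (Finset.mem_coe.1 hk)).2
          have h2 := (Finset.mem_filter.1 (Finset.mem_coe.1 hk')).2
          have hmod : k % q = k' % q := (ZMod.natCast_eq_natCast_iff' k k' q).1 (h1.trans h2.symm)
          have hdiv : k / q = k' / q := h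
          calc k = q * (k / q) + k % q := (Nat.div_add_mod k q).symm
            _ = q * (k' / q) + k' % q := by rw [hdiv, hmod]
            _ = k' := Nat.div_add_mod k' q
    _ = N / q + 1 := Finset.card_range _

/-- **Exponential sums in mean square over `a mod q`**: for coefficients `b_k` on `1 ≤ k ≤ N`,
`∑_{a mod q} |∑_{k ≤ N} b_k e(ak/q)|² ≤ q (N/q + 1) ∑_{k ≤ N} |b_k|²` (Parseval after folding the
coefficients into residue classes, Cauchy–Schwarz inside each class).
[cite: CojocaruMurty2005, Thm 8.3.1 (proof)] -/
theorem sum_norm_sq_expSum_le (N : ℕ) (b : ℕ → ℂ) :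
    ∑ a : ZMod q, ‖∑ k ∈ Icc 1 N, b k * ZMod.stdAddChar ((k : ZMod q) * a)‖ ^ 2 ≤
      (q : ℝ) * ((N / q : ℕ) + 1) * ∑ k ∈ Icc 1 N, ‖b k‖ ^ 2 := by
  classical
  -- fold the coefficients: `B r = ∑_{k ≤ N, k ≡ r} b_k`
  set B : ZMod q → ℂ := fun r => ∑ k ∈ Icc 1 N with ((k : ℕ) : ZMod q) = r, b k with hB
  have hfold : ∀ a : ZMod q, ∑ k ∈ Icc 1 N, b k * ZMod.stdAddChar ((k : ZMod q) * a) =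
      ∑ r : ZMod q, B r * ZMod.stdAddChar (r * a) := by
    intro a
    rw [← Finset.sum_fiberwise (Icc 1 N) (fun k : ℕ => (k : ZMod q))
      (fun k => b k * ZMod.stdAddChar ((k : ZMod q) * a))]
    refine Finset.sum_congr rfl fun r _ => ?_
    rw [hB, Finset.sum_mul]
    refine Finset.sum_congr rfl fun k hk => ?_
    rw [(Finset.mem_filter.1 hk).2]
  simp_rw [hfold]
  rw [sum_norm_sq_sum_mul_stdAddChar B, mul_assoc]
  refine mul_le_mul_of_nonneg_left ?_ (Nat.cast_nonneg q)
  -- Cauchy–Schwarz in each residue class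
  have hcs : ∀ r : ZMod q, ‖B r‖ ^ 2 ≤ ((N / q : ℕ) + 1 : ℝ) *
      ∑ k ∈ Icc 1 N with ((k : ℕ) : ZMod q) = r, ‖b k‖ ^ 2 := by
    intro r
    calc ‖B r‖ ^ 2 ≤ (∑ k ∈ Icc 1 N with ((k : ℕ) : ZMod q) = r, ‖b k‖) ^ 2 := by
          rw [hB]
          gcongr
          exact norm_sum_le _ _
      _ ≤ #{k ∈ Icc 1 N | ((k : ℕ) : ZMod q) = r} * ∑ k ∈ Icc 1 N with ((k : ℕ) : ZMod q) = r, ‖b k‖ ^ 2 :=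
          sq_sum_le_card_mul_sum_sq
      _ ≤ ((N / q : ℕ) + 1 : ℝ) * ∑ k ∈ Icc 1 N with ((k : ℕ) : ZMod q) = r, ‖b k‖ ^ 2 := by
          refine mul_le_mul_of_nonneg_right ?_ (Finset.sum_nonneg fun k _ => by positivity)
          exact_mod_cast card_filter_Icc_natCast_eq_le N r
  calc ∑ r : ZMod q, ‖B r‖ ^ 2
      ≤ ∑ r : ZMod q, ((N / q : ℕ) + 1 : ℝ) * ∑ k ∈ Icc 1 N with ((k : ℕ) : ZMod q) = r, ‖b k‖ ^ 2 :=
        Finset.sum_le_sum fun r _ => hcs r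
    _ = ((N / q : ℕ) + 1 : ℝ) * ∑ k ∈ Icc 1 N, ‖b k‖ ^ 2 := by
        rw [← Finset.mul_sum, Finset.sum_fiberwise (Icc 1 N) (fun k : ℕ => (k : ZMod q)) (fun k => ‖b k‖ ^ 2)]

/-! ### 3. Completion: primitive characters as finite Fourier transforms of themselves -/

/-- For `χ` primitive mod `q` and EVERY residue `y` (unit or not),
`τ(χ̄) χ(y) = ∑_{a mod q} χ̄(a) e(ay/q)` (Mathlib's
`IsPrimitive.fourierTransform_eq_inv_mul_gaussSum`; both sides vanish when `(y, q) > 1`).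
[cite: CojocaruMurty2005, (8.16)] -/
theorem gaussSum_inv_mul_apply {χ : DirichletCharacter ℂ q} (hχ : χ.IsPrimitive) (y : ZMod q) :
    gaussSum χ⁻¹ ZMod.stdAddChar * χ y = ∑ a : ZMod q, χ⁻¹ a * ZMod.stdAddChar (a * y) := by
  have h2 := (isPrimitive_inv hχ).fourierTransform_eq_inv_mul_gaussSum (-y)
  rw [ZMod.dft_apply, inv_inv, neg_neg] at h2
  simp only [smul_eq_mul, mul_neg, neg_neg] at h2
  rw [mul_comm, ← h2]
  exact Finset.sum_congr rfl fun a _ => mul_comm _ _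

/-- **Completion in mean square**: for `χ` primitive mod `q`, any `N` and any coefficients `b_k`,
`∑_{x mod q} |∑_{k ≤ N} b_k χ(k + x)|² ≤ (q (N/q) + q) ∑_{k ≤ N} |b_k|² (≤ (N + q) ∑ |b_k|²)`.
[cite: BondarenkoHeap2026, §6.4 Lemma 8 (26)] -/
theorem sum_norm_sq_shiftedCharSum_le {χ : DirichletCharacter ℂ q} (hχ : χ.IsPrimitive)
    (N : ℕ) (b : ℕ → ℂ) :
    ∑ x : ZMod q, ‖∑ k ∈ Icc 1 N, b k * χ ((k : ZMod q) + x)‖ ^ 2 ≤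
      (q : ℝ) * ((N / q : ℕ) + 1) * ∑ k ∈ Icc 1 N, ‖b k‖ ^ 2 := by
  classical
  set τ : ℂ := gaussSum χ⁻¹ ZMod.stdAddChar with hτ
  have hτsq : ‖τ‖ ^ 2 = q := norm_gaussSum_sq (isPrimitive_inv hχ)
  have hq : (0 : ℝ) < q := Nat.cast_pos.2 (NeZero.pos q)
  -- the completed coefficients `c a = χ̄(a) β(a)`, `β(a) = ∑_k b_k e(ak/q)`
  set c : ZMod q → ℂ := fun a => χ⁻¹ a * ∑ k ∈ Icc 1 N, b k * ZMod.stdAddChar ((k : ZMod q) * a)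
    with hc
  -- completion: `τ · ∑_k b_k χ(k + x) = ∑_a c_a e(ax/q)`
  have hcompl : ∀ x : ZMod q, τ * ∑ k ∈ Icc 1 N, b k * χ ((k : ZMod q) + x) =
      ∑ a : ZMod q, c a * ZMod.stdAddChar (a * x) := by
    intro x
    calc τ * ∑ k ∈ Icc 1 N, b k * χ ((k : ZMod q) + x)
        = ∑ k ∈ Icc 1 N, b k * (τ * χ ((k : ZMod q) + x)) := by
          rw [Finset.mul_sum]; exact Finset.sum_congr rfl fun k _ => by ring
      _ = ∑ k ∈ Icc 1 N, ∑ a : ZMod q,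
            b k * (χ⁻¹ a * (ZMod.stdAddChar ((k : ZMod q) * a) * ZMod.stdAddChar (a * x))) := by
          refine Finset.sum_congr rfl fun k _ => ?_
          rw [hτ, gaussSum_inv_mul_apply hχ, Finset.mul_sum]
          refine Finset.sum_congr rfl fun a _ => ?_
          rw [← AddChar.map_add_eq_mul, show (k : ZMod q) * a + a * x = a * ((k : ZMod q) + x) by ring]
      _ = ∑ a : ZMod q, c a * ZMod.stdAddChar (a * x) := by
          rw [Finset.sum_comm]
          refine Finset.sum_congr rfl fun a _ => ?_
          simp only [hc, Finset.mul_sum, Finset.sum_mul]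
          exact Finset.sum_congr rfl fun k _ => by ring
  -- `q · LHS = ∑_x |τ f(x)|² = q ∑_a |c_a|² ≤ q ∑_a |β(a)|² ≤ q · q (N/q + 1) ∑ |b_k|²`
  have hkey : (q : ℝ) * ∑ x : ZMod q, ‖∑ k ∈ Icc 1 N, b k * χ ((k : ZMod q) + x)‖ ^ 2 =
      (q : ℝ) * ∑ a : ZMod q, ‖c a‖ ^ 2 := by
    rw [← sum_norm_sq_sum_mul_stdAddChar c, Finset.mul_sum]
    refine Finset.sum_congr rfl fun x _ => ?_
    rw [← hcompl x, norm_mul, mul_pow, hτsq]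
  have hcle : ∀ a : ZMod q, ‖c a‖ ^ 2 ≤ ‖∑ k ∈ Icc 1 N, b k * ZMod.stdAddChar ((k : ZMod q) * a)‖ ^ 2 := by
    intro a
    simp only [hc]
    rw [norm_mul, mul_pow]
    have h1 : ‖χ⁻¹ a‖ ^ 2 ≤ 1 := by
      have := DirichletCharacter.norm_le_one χ⁻¹ a
      have h0 := norm_nonneg (χ⁻¹ a)
      nlinarith
    nlinarith [sq_nonneg ‖∑ k ∈ Icc 1 N, b k * ZMod.stdAddChar ((k : ZMod q) * a)‖]
  have h := calc (q : ℝ) * ∑ x : ZMod q, ‖∑ k ∈ Icc 1 N, b k * χ ((k : ZMod q) + x)‖ ^ 2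
      = (q : ℝ) * ∑ a : ZMod q, ‖c a‖ ^ 2 := hkey
    _ ≤ (q : ℝ) * ∑ a : ZMod q, ‖∑ k ∈ Icc 1 N, b k * ZMod.stdAddChar ((k : ZMod q) * a)‖ ^ 2 :=
        mul_le_mul_of_nonneg_left (Finset.sum_le_sum fun a _ => hcle a) hq.le
    _ ≤ (q : ℝ) * ((q : ℝ) * ((N / q : ℕ) + 1) * ∑ k ∈ Icc 1 N, ‖b k‖ ^ 2) :=
        mul_le_mul_of_nonneg_left (sum_norm_sq_expSum_le N b) hq.le
  exact le_of_mul_le_mul_left h hq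

/-! ### 4. Lemma 8 -/

/-- **BH26:Lem8 proved** (Lemma 8, (26), TeX l.945–955), with `C = 2` for every `ε > 0`:
for `χ` primitive [quadratic] mod `q`, `K ≥ 1` and `b_k` supported on `K ≤ k ≤ 2K`,
`∑_{x mod q} |∑_k b_k χ(k + x)|² ≤ 2 q^ε (q + K) ∑_k |b_k|²`.  Completion argument
(`sum_norm_sq_shiftedCharSum_le`: the bound `(q + 2K) ∑|b_k|²`), then `q ⌊2K⌋/q + q ≤ 2(q + K)`
and `1 ≤ q^ε`.  NOT RH-BEARING. [cite: BondarenkoHeap2026, §6.4 Lemma 8 (26)] -/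
theorem _root_.Literature.NumberTheory.LFunctions.BondarenkoHeap2026.lemma8_holds : lemma8 := by
  intro ε hε
  refine ⟨2, two_pos, ?_⟩
  intro q _ χ hχ _ K hK b _
  have hq1 : (1 : ℝ) ≤ q := Nat.one_le_cast.2 (NeZero.one_le)
  have hq : (0 : ℝ) < q := by linarith
  set N : ℕ := ⌊2 * K⌋₊ with hN
  set S : ℝ := ∑ k ∈ Icc 1 N, ‖b k‖ ^ 2 with hS
  have hS0 : 0 ≤ S := Finset.sum_nonneg fun k _ => by positivity
  have h1 := sum_norm_sq_shiftedCharSum_le hχ N b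
  -- `q (⌊2K⌋ / q) + q ≤ 2K + q ≤ 2 (q + K) ≤ 2 q^ε (q + K)`
  have hNq : (q : ℝ) * ((N / q : ℕ) + 1) ≤ 2 * K + q := by
    have hdiv : ((N / q : ℕ) : ℝ) * q ≤ N := by exact_mod_cast Nat.div_mul_le_self N q
    have hNle : (N : ℝ) ≤ 2 * K := Nat.floor_le (by linarith)
    nlinarith
  have hε1 : (1 : ℝ) ≤ (q : ℝ) ^ ε := Real.one_le_rpow hq1 hε.le
  calc ∑ x : ZMod q, ‖∑ k ∈ Icc 1 N, b k * χ ((k : ZMod q) + x)‖ ^ 2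
      ≤ (q : ℝ) * ((N / q : ℕ) + 1) * S := h1
    _ ≤ (2 * K + q) * S := mul_le_mul_of_nonneg_right hNq hS0
    _ ≤ 2 * (q : ℝ) ^ ε * ((q : ℝ) + K) * S := by
        apply mul_le_mul_of_nonneg_right _ hS0
        nlinarith [hK, hq]

end CharacterSums

end Literature.NumberTheory.LFunctions.BondarenkoHeap2026
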